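import Summits.AtomisticToContinuum.BoseEinsteinCondensation.Theorems.BECConjugateDominationInfraredMinimumUncertaintyTiltedLineReduction
import Summits.AtomisticToContinuum.BoseEinsteinCondensation.Theorems.BECConjugateDominationInfraredMinimumUncertaintyFreeScaleLaw
import Summits.AtomisticToContinuum.BoseEinsteinCondensation.Theorems.BECConjugateDominationInfraredMinimumUncertaintyLineCircularity
import Summits.AtomisticToContinuum.BoseEinsteinCondensation.Theorems.BECConjugateDominationPuffFloor
import Summits.AtomisticToContinuum.BoseEinsteinCondensation.Theorems.BECConjugateDominationNearMinimiserStabilityProof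
import HarnessLib

/-!
# Route `BECConjugateDomination`, crux `InfraredMinimumUncertainty` (stmt-AtomisticToContinuum-11784):
# strength certificates with every closed item of the route discharged

Supports (does not close) stmt-AtomisticToContinuum-11784.  Seat prover-line-stmt-AtomisticToContinuum-11784-c2-0
(line lead c2, line `tilted-coherence-work-variance`, reshape r2), 2026-08-16.

Since the necessity/sufficiency files of the two lines were landed, the route's other analytic items CLOSED:
`PuffFloor` (stmt-11785, `Theorems.PuffFloor_proof`), `NearMinimiserStability` (stmt-11788,
`Theorems.nearMinimiserStability_proof`), `PositiveMinimiser` (stmt-11787), `ShortDistanceCoherence`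
(stmt-11789), `IMUChainGlue` (stmt-11790).  Discharging them in the landed compositions gives the
UNCONDITIONAL implications below, which fix the strength class of what is still open:

* `smoothPeriodicBEC_of_infraredMinimumUncertainty : InfraredMinimumUncertainty → SmoothPeriodicBEC` —
  the crux alone now yields thermodynamic-limit ground-state BEC on the torus for the whole smooth class
  (the route's rank-0 target, stmt-11783; LSSY2005 Ch. 5: open).  Any proof of the crux is a proof of that.
* `smoothPeriodicBEC_of_tiltedUncertaintyHalfTilts : TiltedUncertaintyHalfTilts → SmoothPeriodicBEC` — the
  SINGLE OPEN STUB S34 of the line `tilted-coherence-work-variance` (`stub_tiltedUncertaintyHalfTilts`, the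
  half-tilt work-variance ceiling `Π_t(m) ≤ C`, `t ∈ [0,½]`) is itself of thermodynamic-limit-BEC strength:
  kernel-checked, no longer "conceded".
* `levyFreeScaleLaw_of_infraredMinimumUncertainty : InfraredMinimumUncertainty → LevyFreeScaleLaw` — with
  `PuffFloor` proved, the crux implies the floor-free, structure-factor-free Lévy law
  `N‖k‖²ν_m ≤ C(‖k‖² + ρ)` that the deciding chain actually consumes (`…FreeScaleLaw.lean`).
* `boseEinsteinCondensation_of_infraredMinimumUncertainty :
    InfraredMinimumUncertainty → BoundaryTransferWeak → HardCoreExtension → BoseEinsteinCondensation` — the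
  route's deciding theorem `closes` with its five closed items discharged: the route IS now the conditional
  bridge "IMU ∧ BoundaryTransferWeak (stmt-0827) ∧ HardCoreExtension (stmt-11786) ⇒ conjunct".

Pure logic over landed theorems; no definitions, no facts, no analysis.
-/

namespace Summit.AtomisticToContinuum.BoseEinsteinCondensation.Theorems.BECConjugateDomination

open Summit.AtomisticToContinuum.BoseEinsteinCondensation.Theses.BECConjugateDomination
  (InfraredMinimumUncertainty PuffFloor NearMinimiserStability SmoothPeriodicBEC BoundaryTransferWeak
    HardCoreExtension)
open Summit.AtomisticToContinuum.BoseEinsteinCondensation.Theorems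
  (PuffFloor_proof nearMinimiserStability_proof)
open Summit.AtomisticToContinuum.BoseEinsteinCondensation.Cruxes.InfraredMinimumUncertainty.FisherGaussianDensityMode
  (LevyFreeScaleLaw smoothPeriodicBEC_of_imu levyFreeScaleLaw_of_imu_of_puffFloor
    boseEinsteinCondensation_of_levyFreeScaleLaw)

/-- **The crux alone gives thermodynamic-limit torus BEC for the smooth class (unconditional implication).**
`InfraredMinimumUncertainty → SmoothPeriodicBEC`: the landed `smoothPeriodicBEC_of_imu`
(`…LineCircularity.lean`: IMU → PuffFloor → NearMinimiserStability → SmoothPeriodicBEC, itself the glue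
`imuChainGlue_proof` with `PositiveMinimiser_proof` and `shortDistanceCoherence_proof` discharged) fed with the
now-closed `PuffFloor_proof` (stmt-11785) and `nearMinimiserStability_proof` (stmt-11788). -/
theorem smoothPeriodicBEC_of_infraredMinimumUncertainty :
    InfraredMinimumUncertainty → SmoothPeriodicBEC := fun hI =>
  smoothPeriodicBEC_of_imu hI PuffFloor_proof nearMinimiserStability_proof

/-- **The open stub S34 of line `tilted-coherence-work-variance` is of thermodynamic-limit-BEC strength
(kernel-checked).** `TiltedUncertaintyHalfTilts → SmoothPeriodicBEC`: the half-tilt work-variance ceiling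
`Π_t(m) ≤ C` (`t ∈ [0,½]`, positive minimisers with the tilted generator identity) implies the crux
(`imu_of_tiltedUncertaintyHalfTilts`, `…TiltedLineReduction.lean`: S1 p119407, S2 p119409, tilt reflection
p119764), hence smooth-class torus BEC in the thermodynamic limit. -/
theorem smoothPeriodicBEC_of_tiltedUncertaintyHalfTilts :
    TiltedUncertaintyHalfTilts → SmoothPeriodicBEC := fun h34 =>
  smoothPeriodicBEC_of_infraredMinimumUncertainty (imu_of_tiltedUncertaintyHalfTilts h34)

/-- **With `PuffFloor` proved, the crux implies the free-scale Lévy law unconditionally.**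
`InfraredMinimumUncertainty → LevyFreeScaleLaw` (`N‖k‖²ν_m ≤ C(‖k‖² + ρ)` in the crux frame): the landed
`levyFreeScaleLaw_of_imu_of_puffFloor` with `PuffFloor_proof` discharged. -/
theorem levyFreeScaleLaw_of_infraredMinimumUncertainty :
    InfraredMinimumUncertainty → LevyFreeScaleLaw := fun hI =>
  levyFreeScaleLaw_of_imu_of_puffFloor hI PuffFloor_proof

/-- **The route as it now stands: a conditional bridge on three open items.** The deciding theorem `closes`
of route `BECConjugateDomination` with its five closed items (`PuffFloor`, `PositiveMinimiser`,
`NearMinimiserStability`, `ShortDistanceCoherence`, `IMUChainGlue`) discharged: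
`InfraredMinimumUncertainty → BoundaryTransferWeak → HardCoreExtension → BoseEinsteinCondensation`
(the sub-problem Statement, by name), via the free-scale law. -/
theorem boseEinsteinCondensation_of_infraredMinimumUncertainty :
    InfraredMinimumUncertainty → BoundaryTransferWeak → HardCoreExtension →
      _root_.BoseEinsteinCondensation := fun hI hBT hHC =>
  boseEinsteinCondensation_of_levyFreeScaleLaw (levyFreeScaleLaw_of_infraredMinimumUncertainty hI) hBT hHC
    nearMinimiserStability_proof

end Summit.AtomisticToContinuum.BoseEinsteinCondensation.Theorems.BECConjugateDomination
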